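import Literature.AlgebraicGeometry.HodgeTheory.RibetTypeSeventyThreefoldPowersHodgeClasses
import Literature.AlgebraicGeometry.Motives.HodgeThetaSubalgebraUnitarySeventyNineGoodRankCores
import HarnessLib

/-!
# Hodge classes on all powers of abelian varieties of Ribet type `(8, 71)`, `(12, 67)`, `(18, 61)`, `(20, 59)`, `(26, 53)`, `(32, 47)`, `(36, 43)`, `(38, 41)` are generated by divisor classes
# (Ribet 1983 Thm. 3 at these multiplicities — UNCONDITIONAL); the first census of SIMPLE ABELIAN 79-FOLDS

Family `hodge`, layer `Literature/AlgebraicGeometry/HodgeTheory`. Research context: cell `pub-hodge-ring2` (HONEST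
FRAMING: research route conditional on HC_CM; not a corollary; Q11.4-sentence-2 already refuted in dim ≥ 3),
Literature lane gen 89. UNCONDITIONAL for the class of abelian varieties it names; theorems only, no definition, no
named fact (D-0026), no `sorry`. The CELLS of the generic assembly `RibetTypeOfCoreSmulPowersHodgeClasses` at the
good-rank cores of `Motives/HodgeThetaSubalgebraUnitarySeventyNineGoodRankCores` (every raising rank is good), and the
census of the prime dimension `79` they begin (`isDivisorGenerated_powSucc_of_isSimple_of_prime_of_odd_of_ge_eight_notin`
grants only the imaginary-quadratic shapes with both multiplicities `≥ 8` and `∉ {11, 13}`; of these `{8, 71}`, `{12, 67}`, `{18, 61}`, `{20, 59}`, `{26, 53}`, `{32, 47}`, `{36, 43}`, `{38, 41}`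
are theorems here), exactly as `RibetTypeFortyThreefoldPowersHodgeClasses` did for `43`.

THE PRINTED THEOREM. Ribet, Amer. J. Math. 105 (1983), Thm. 3 = Gordon's survey Thm. 6.3 (3) [held
`paper:arxiv-alg-geom_9709030` p. 18]: for an abelian variety `A` with `End⁰(A)` an imaginary quadratic field `K` acting
with relatively prime multiplicities `(n′, n″)`, `Hg(A) = Lf(A)` and the Hodge ring of every power of `A` is generated by
divisors (ibid. Thm. 6.2 = Ribet Thm. 0).

* §1 the cells `(8, 71)`, `(12, 67)`, `(18, 61)`, `(20, 59)`, `(26, 53)`, `(32, 47)`, `(36, 43)`, `(38, 41)` (and mirrors), the Hodge conjecture for these powers, 79-FOLDS of these signatures.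
* §2 `isDivisorGenerated_powSucc_of_isSimple_seventyninefold`: `B• = D•` on all powers of a simple `79`-fold granted
  only `End⁰ = ℚ` and the `k`-signatures `{9, 70}`, `{10, 69}`, `{14, 65}`, `{15, 64}`, `{16, 63}`, `{17, 62}`, `{19, 60}`, `{21, 58}`, `{22, 57}`, `{23, 56}`, `{24, 55}`, `{25, 54}`, `{27, 52}`, `{28, 51}`, `{29, 50}`, `{30, 49}`, `{31, 48}`, `{33, 46}`, `{34, 45}`, `{35, 44}`, `{37, 42}`, `{39, 40}`.

## References
* [Ribet1983] K. A. Ribet, Amer. J. Math. 105 (1983), Thm. 0 and Thm. 3.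
* [Gordon1997] B. B. Gordon, *A survey of the Hodge conjecture for abelian varieties*, Thm. 6.3 (3) and Corollary.
* [MoonenZarhin1999LowDim] B. Moonen, Yu. Zarhin, Math. Ann. 315 (1999), §2 (2.4), Thm. (2.7).
* [Deligne2000] P. Deligne, *The Hodge conjecture* (Clay, 2000), §1.
-/

noncomputable section

open CategoryTheory Module

namespace Literature.AlgebraicGeometry.HodgeTheory

open Literature.AlgebraicGeometry.Motives
open Literature.AlgebraicGeometry.Motives.HodgeStructure

section Cells

/-- **Ribet 1983 Thm. 3 at `(n′, n″) = (8, 71)` — UNCONDITIONAL** (core `UnitaryEightSeventyOne.eq_top_of_smul`).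
[cite: Ribet1983, Thm. 0 and Thm. 3] [cite: Gordon1997, Thm. 6.3 (3) and Corollary] -/
theorem AbelianVariety.isDivisorGenerated_powSucc_of_ribetTypeEightSeventyOne (A : AbelianVariety ℂ) (φ : A ⟶ A)
    {d : ℕ} (hd : 0 < d) (hφ : φ ≫ φ = -(d • 𝟙 A)) (hE2 : Module.finrank ℚ A.endAlgebra = 2)
    (h8 : eigenMultiplicity A φ (Complex.I * (Real.sqrt d : ℂ)) = 8)
    (h71 : eigenMultiplicity A φ (-(Complex.I * (Real.sqrt d : ℂ))) = 71) (N : ℕ) :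
    IsDivisorGenerated (A.powSucc N) := by
  refine AbelianVariety.isDivisorGenerated_powSucc_of_ribetType_ofCoreSmul A φ hd hφ hE2 (by omega) (by omega) ?_ N
  intro W' _ _ _ 𝔊 ι P' Q' s hbr hirr hι hιι hP' hQ' hfinP' hfinQ' hadd hsmul hsymm hPQ hdefP hdefQ hadj
  exact UnitaryEightSeventyOne.eq_top_of_smul hbr hirr hι hιι hP' hQ' (by rw [hfinP', h8]) (by rw [hfinQ', h71]) hadd
    hsmul hsymm hPQ hdefP hdefQ hadj

/-- The mirror: `n_{i√d}(φ) = 71`, `n_{−i√d}(φ) = 8` (core `UnitaryEightSeventyOne.eq_top_of_smul'`).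
[cite: Ribet1983, Thm. 0 and Thm. 3] [cite: Gordon1997, Thm. 6.3 (3) and Corollary] -/
theorem AbelianVariety.isDivisorGenerated_powSucc_of_ribetTypeEightSeventyOne' (A : AbelianVariety ℂ) (φ : A ⟶ A)
    {d : ℕ} (hd : 0 < d) (hφ : φ ≫ φ = -(d • 𝟙 A)) (hE2 : Module.finrank ℚ A.endAlgebra = 2)
    (h71 : eigenMultiplicity A φ (Complex.I * (Real.sqrt d : ℂ)) = 71)
    (h8 : eigenMultiplicity A φ (-(Complex.I * (Real.sqrt d : ℂ))) = 8) (N : ℕ) :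
    IsDivisorGenerated (A.powSucc N) := by
  refine AbelianVariety.isDivisorGenerated_powSucc_of_ribetType_ofCoreSmul A φ hd hφ hE2 (by omega) (by omega) ?_ N
  intro W' _ _ _ 𝔊 ι P' Q' s hbr hirr hι hιι hP' hQ' hfinP' hfinQ' hadd hsmul hsymm hPQ hdefP hdefQ hadj
  exact UnitaryEightSeventyOne.eq_top_of_smul' hbr hirr hι hιι hP' hQ' (by rw [hfinP', h71]) (by rw [hfinQ', h8])
    hadd hsmul hsymm hPQ hdefP hdefQ hadj

/-- **The Hodge conjecture for all powers `A^{N+1}` of an abelian variety of Ribet type `(8, 71)` — UNCONDITIONAL.**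
[cite: Ribet1983, Thm. 3] [cite: Deligne2000, §1] -/
theorem hodgeConjectureFor_powSucc_of_ribetTypeEightSeventyOne (A : AbelianVariety ℂ) (φ : A ⟶ A)
    {d : ℕ} (hd : 0 < d) (hφ : φ ≫ φ = -(d • 𝟙 A)) (hE2 : Module.finrank ℚ A.endAlgebra = 2)
    (h8 : eigenMultiplicity A φ (Complex.I * (Real.sqrt d : ℂ)) = 8)
    (h71 : eigenMultiplicity A φ (-(Complex.I * (Real.sqrt d : ℂ))) = 71) (N : ℕ) :
    HodgeConjectureFor (A.powSucc N).dim (A.powSucc N).X :=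
  hodgeConjectureFor_of_isDivisorGenerated _
    (AbelianVariety.isDivisorGenerated_powSucc_of_ribetTypeEightSeventyOne A φ hd hφ hE2 h8 h71 N)

/-- **79-FOLDS of signature `{8, 71}`: `B• = D•` on all powers — UNCONDITIONAL** (either eigenvalue may carry the `8`).
[cite: Ribet1983, Thm. 0 and Thm. 3] [cite: MoonenZarhin1999LowDim, §2 (2.4)] -/
theorem AbelianVariety.isDivisorGenerated_powSucc_of_seventyninefold_eightSeventyOne (A : AbelianVariety ℂ)
    (φ : A ⟶ A) {d : ℕ} (hd : 0 < d) (hφ : φ ≫ φ = -(d • 𝟙 A)) (hE2 : Module.finrank ℚ A.endAlgebra = 2)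
    (hX : A.dim = 79)
    (h8 : eigenMultiplicity A φ (Complex.I * (Real.sqrt d : ℂ)) = 8 ∨
      eigenMultiplicity A φ (-(Complex.I * (Real.sqrt d : ℂ))) = 8)
    (N : ℕ) : IsDivisorGenerated (A.powSucc N) := by
  have hsum := eigenMultiplicity_add_eigenMultiplicity_neg_eq_dim A φ hd hφ
  rw [hX] at hsum
  rcases h8 with h | h
  · exact AbelianVariety.isDivisorGenerated_powSucc_of_ribetTypeEightSeventyOne A φ hd hφ hE2 h (by omega) N
  · exact AbelianVariety.isDivisorGenerated_powSucc_of_ribetTypeEightSeventyOne' A φ hd hφ hE2 (by omega) h N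

/-- **The Hodge conjecture for all powers of a 79-FOLD of signature `{8, 71}` — UNCONDITIONAL.**
[cite: Ribet1983, Thm. 3] [cite: Deligne2000, §1] -/
theorem hodgeConjectureFor_powSucc_of_seventyninefold_eightSeventyOne (A : AbelianVariety ℂ)
    (φ : A ⟶ A) {d : ℕ} (hd : 0 < d) (hφ : φ ≫ φ = -(d • 𝟙 A)) (hE2 : Module.finrank ℚ A.endAlgebra = 2)
    (hX : A.dim = 79)
    (h8 : eigenMultiplicity A φ (Complex.I * (Real.sqrt d : ℂ)) = 8 ∨
      eigenMultiplicity A φ (-(Complex.I * (Real.sqrt d : ℂ))) = 8)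
    (N : ℕ) : HodgeConjectureFor (A.powSucc N).dim (A.powSucc N).X :=
  hodgeConjectureFor_of_isDivisorGenerated _
    (AbelianVariety.isDivisorGenerated_powSucc_of_seventyninefold_eightSeventyOne A φ hd hφ hE2 hX h8 N)

/-- **Ribet 1983 Thm. 3 at `(n′, n″) = (12, 67)` — UNCONDITIONAL** (core `UnitaryTwelveSixtySeven.eq_top_of_smul`).
[cite: Ribet1983, Thm. 0 and Thm. 3] [cite: Gordon1997, Thm. 6.3 (3) and Corollary] -/
theorem AbelianVariety.isDivisorGenerated_powSucc_of_ribetTypeTwelveSixtySeven (A : AbelianVariety ℂ) (φ : A ⟶ A)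
    {d : ℕ} (hd : 0 < d) (hφ : φ ≫ φ = -(d • 𝟙 A)) (hE2 : Module.finrank ℚ A.endAlgebra = 2)
    (h12 : eigenMultiplicity A φ (Complex.I * (Real.sqrt d : ℂ)) = 12)
    (h67 : eigenMultiplicity A φ (-(Complex.I * (Real.sqrt d : ℂ))) = 67) (N : ℕ) :
    IsDivisorGenerated (A.powSucc N) := by
  refine AbelianVariety.isDivisorGenerated_powSucc_of_ribetType_ofCoreSmul A φ hd hφ hE2 (by omega) (by omega) ?_ N
  intro W' _ _ _ 𝔊 ι P' Q' s hbr hirr hι hιι hP' hQ' hfinP' hfinQ' hadd hsmul hsymm hPQ hdefP hdefQ hadj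
  exact UnitaryTwelveSixtySeven.eq_top_of_smul hbr hirr hι hιι hP' hQ' (by rw [hfinP', h12]) (by rw [hfinQ', h67]) hadd
    hsmul hsymm hPQ hdefP hdefQ hadj

/-- The mirror: `n_{i√d}(φ) = 67`, `n_{−i√d}(φ) = 12` (core `UnitaryTwelveSixtySeven.eq_top_of_smul'`).
[cite: Ribet1983, Thm. 0 and Thm. 3] [cite: Gordon1997, Thm. 6.3 (3) and Corollary] -/
theorem AbelianVariety.isDivisorGenerated_powSucc_of_ribetTypeTwelveSixtySeven' (A : AbelianVariety ℂ) (φ : A ⟶ A)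
    {d : ℕ} (hd : 0 < d) (hφ : φ ≫ φ = -(d • 𝟙 A)) (hE2 : Module.finrank ℚ A.endAlgebra = 2)
    (h67 : eigenMultiplicity A φ (Complex.I * (Real.sqrt d : ℂ)) = 67)
    (h12 : eigenMultiplicity A φ (-(Complex.I * (Real.sqrt d : ℂ))) = 12) (N : ℕ) :
    IsDivisorGenerated (A.powSucc N) := by
  refine AbelianVariety.isDivisorGenerated_powSucc_of_ribetType_ofCoreSmul A φ hd hφ hE2 (by omega) (by omega) ?_ N
  intro W' _ _ _ 𝔊 ι P' Q' s hbr hirr hι hιι hP' hQ' hfinP' hfinQ' hadd hsmul hsymm hPQ hdefP hdefQ hadj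
  exact UnitaryTwelveSixtySeven.eq_top_of_smul' hbr hirr hι hιι hP' hQ' (by rw [hfinP', h67]) (by rw [hfinQ', h12])
    hadd hsmul hsymm hPQ hdefP hdefQ hadj

/-- **The Hodge conjecture for all powers `A^{N+1}` of an abelian variety of Ribet type `(12, 67)` — UNCONDITIONAL.**
[cite: Ribet1983, Thm. 3] [cite: Deligne2000, §1] -/
theorem hodgeConjectureFor_powSucc_of_ribetTypeTwelveSixtySeven (A : AbelianVariety ℂ) (φ : A ⟶ A)
    {d : ℕ} (hd : 0 < d) (hφ : φ ≫ φ = -(d • 𝟙 A)) (hE2 : Module.finrank ℚ A.endAlgebra = 2)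
    (h12 : eigenMultiplicity A φ (Complex.I * (Real.sqrt d : ℂ)) = 12)
    (h67 : eigenMultiplicity A φ (-(Complex.I * (Real.sqrt d : ℂ))) = 67) (N : ℕ) :
    HodgeConjectureFor (A.powSucc N).dim (A.powSucc N).X :=
  hodgeConjectureFor_of_isDivisorGenerated _
    (AbelianVariety.isDivisorGenerated_powSucc_of_ribetTypeTwelveSixtySeven A φ hd hφ hE2 h12 h67 N)

/-- **79-FOLDS of signature `{12, 67}`: `B• = D•` on all powers — UNCONDITIONAL** (either eigenvalue may carry the `12`).
[cite: Ribet1983, Thm. 0 and Thm. 3] [cite: MoonenZarhin1999LowDim, §2 (2.4)] -/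
theorem AbelianVariety.isDivisorGenerated_powSucc_of_seventyninefold_twelveSixtySeven (A : AbelianVariety ℂ)
    (φ : A ⟶ A) {d : ℕ} (hd : 0 < d) (hφ : φ ≫ φ = -(d • 𝟙 A)) (hE2 : Module.finrank ℚ A.endAlgebra = 2)
    (hX : A.dim = 79)
    (h12 : eigenMultiplicity A φ (Complex.I * (Real.sqrt d : ℂ)) = 12 ∨
      eigenMultiplicity A φ (-(Complex.I * (Real.sqrt d : ℂ))) = 12)
    (N : ℕ) : IsDivisorGenerated (A.powSucc N) := by
  have hsum := eigenMultiplicity_add_eigenMultiplicity_neg_eq_dim A φ hd hφ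
  rw [hX] at hsum
  rcases h12 with h | h
  · exact AbelianVariety.isDivisorGenerated_powSucc_of_ribetTypeTwelveSixtySeven A φ hd hφ hE2 h (by omega) N
  · exact AbelianVariety.isDivisorGenerated_powSucc_of_ribetTypeTwelveSixtySeven' A φ hd hφ hE2 (by omega) h N

/-- **The Hodge conjecture for all powers of a 79-FOLD of signature `{12, 67}` — UNCONDITIONAL.**
[cite: Ribet1983, Thm. 3] [cite: Deligne2000, §1] -/
theorem hodgeConjectureFor_powSucc_of_seventyninefold_twelveSixtySeven (A : AbelianVariety ℂ)
    (φ : A ⟶ A) {d : ℕ} (hd : 0 < d) (hφ : φ ≫ φ = -(d • 𝟙 A)) (hE2 : Module.finrank ℚ A.endAlgebra = 2)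
    (hX : A.dim = 79)
    (h12 : eigenMultiplicity A φ (Complex.I * (Real.sqrt d : ℂ)) = 12 ∨
      eigenMultiplicity A φ (-(Complex.I * (Real.sqrt d : ℂ))) = 12)
    (N : ℕ) : HodgeConjectureFor (A.powSucc N).dim (A.powSucc N).X :=
  hodgeConjectureFor_of_isDivisorGenerated _
    (AbelianVariety.isDivisorGenerated_powSucc_of_seventyninefold_twelveSixtySeven A φ hd hφ hE2 hX h12 N)

/-- **Ribet 1983 Thm. 3 at `(n′, n″) = (18, 61)` — UNCONDITIONAL** (core `UnitaryEighteenSixtyOne.eq_top_of_smul`).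
[cite: Ribet1983, Thm. 0 and Thm. 3] [cite: Gordon1997, Thm. 6.3 (3) and Corollary] -/
theorem AbelianVariety.isDivisorGenerated_powSucc_of_ribetTypeEighteenSixtyOne (A : AbelianVariety ℂ) (φ : A ⟶ A)
    {d : ℕ} (hd : 0 < d) (hφ : φ ≫ φ = -(d • 𝟙 A)) (hE2 : Module.finrank ℚ A.endAlgebra = 2)
    (h18 : eigenMultiplicity A φ (Complex.I * (Real.sqrt d : ℂ)) = 18)
    (h61 : eigenMultiplicity A φ (-(Complex.I * (Real.sqrt d : ℂ))) = 61) (N : ℕ) :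
    IsDivisorGenerated (A.powSucc N) := by
  refine AbelianVariety.isDivisorGenerated_powSucc_of_ribetType_ofCoreSmul A φ hd hφ hE2 (by omega) (by omega) ?_ N
  intro W' _ _ _ 𝔊 ι P' Q' s hbr hirr hι hιι hP' hQ' hfinP' hfinQ' hadd hsmul hsymm hPQ hdefP hdefQ hadj
  exact UnitaryEighteenSixtyOne.eq_top_of_smul hbr hirr hι hιι hP' hQ' (by rw [hfinP', h18]) (by rw [hfinQ', h61]) hadd
    hsmul hsymm hPQ hdefP hdefQ hadj

/-- The mirror: `n_{i√d}(φ) = 61`, `n_{−i√d}(φ) = 18` (core `UnitaryEighteenSixtyOne.eq_top_of_smul'`).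
[cite: Ribet1983, Thm. 0 and Thm. 3] [cite: Gordon1997, Thm. 6.3 (3) and Corollary] -/
theorem AbelianVariety.isDivisorGenerated_powSucc_of_ribetTypeEighteenSixtyOne' (A : AbelianVariety ℂ) (φ : A ⟶ A)
    {d : ℕ} (hd : 0 < d) (hφ : φ ≫ φ = -(d • 𝟙 A)) (hE2 : Module.finrank ℚ A.endAlgebra = 2)
    (h61 : eigenMultiplicity A φ (Complex.I * (Real.sqrt d : ℂ)) = 61)
    (h18 : eigenMultiplicity A φ (-(Complex.I * (Real.sqrt d : ℂ))) = 18) (N : ℕ) :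
    IsDivisorGenerated (A.powSucc N) := by
  refine AbelianVariety.isDivisorGenerated_powSucc_of_ribetType_ofCoreSmul A φ hd hφ hE2 (by omega) (by omega) ?_ N
  intro W' _ _ _ 𝔊 ι P' Q' s hbr hirr hι hιι hP' hQ' hfinP' hfinQ' hadd hsmul hsymm hPQ hdefP hdefQ hadj
  exact UnitaryEighteenSixtyOne.eq_top_of_smul' hbr hirr hι hιι hP' hQ' (by rw [hfinP', h61]) (by rw [hfinQ', h18])
    hadd hsmul hsymm hPQ hdefP hdefQ hadj

/-- **The Hodge conjecture for all powers `A^{N+1}` of an abelian variety of Ribet type `(18, 61)` — UNCONDITIONAL.**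
[cite: Ribet1983, Thm. 3] [cite: Deligne2000, §1] -/
theorem hodgeConjectureFor_powSucc_of_ribetTypeEighteenSixtyOne (A : AbelianVariety ℂ) (φ : A ⟶ A)
    {d : ℕ} (hd : 0 < d) (hφ : φ ≫ φ = -(d • 𝟙 A)) (hE2 : Module.finrank ℚ A.endAlgebra = 2)
    (h18 : eigenMultiplicity A φ (Complex.I * (Real.sqrt d : ℂ)) = 18)
    (h61 : eigenMultiplicity A φ (-(Complex.I * (Real.sqrt d : ℂ))) = 61) (N : ℕ) :
    HodgeConjectureFor (A.powSucc N).dim (A.powSucc N).X :=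
  hodgeConjectureFor_of_isDivisorGenerated _
    (AbelianVariety.isDivisorGenerated_powSucc_of_ribetTypeEighteenSixtyOne A φ hd hφ hE2 h18 h61 N)

/-- **79-FOLDS of signature `{18, 61}`: `B• = D•` on all powers — UNCONDITIONAL** (either eigenvalue may carry the `18`).
[cite: Ribet1983, Thm. 0 and Thm. 3] [cite: MoonenZarhin1999LowDim, §2 (2.4)] -/
theorem AbelianVariety.isDivisorGenerated_powSucc_of_seventyninefold_eighteenSixtyOne (A : AbelianVariety ℂ)
    (φ : A ⟶ A) {d : ℕ} (hd : 0 < d) (hφ : φ ≫ φ = -(d • 𝟙 A)) (hE2 : Module.finrank ℚ A.endAlgebra = 2)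
    (hX : A.dim = 79)
    (h18 : eigenMultiplicity A φ (Complex.I * (Real.sqrt d : ℂ)) = 18 ∨
      eigenMultiplicity A φ (-(Complex.I * (Real.sqrt d : ℂ))) = 18)
    (N : ℕ) : IsDivisorGenerated (A.powSucc N) := by
  have hsum := eigenMultiplicity_add_eigenMultiplicity_neg_eq_dim A φ hd hφ
  rw [hX] at hsum
  rcases h18 with h | h
  · exact AbelianVariety.isDivisorGenerated_powSucc_of_ribetTypeEighteenSixtyOne A φ hd hφ hE2 h (by omega) N
  · exact AbelianVariety.isDivisorGenerated_powSucc_of_ribetTypeEighteenSixtyOne' A φ hd hφ hE2 (by omega) h N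

/-- **The Hodge conjecture for all powers of a 79-FOLD of signature `{18, 61}` — UNCONDITIONAL.**
[cite: Ribet1983, Thm. 3] [cite: Deligne2000, §1] -/
theorem hodgeConjectureFor_powSucc_of_seventyninefold_eighteenSixtyOne (A : AbelianVariety ℂ)
    (φ : A ⟶ A) {d : ℕ} (hd : 0 < d) (hφ : φ ≫ φ = -(d • 𝟙 A)) (hE2 : Module.finrank ℚ A.endAlgebra = 2)
    (hX : A.dim = 79)
    (h18 : eigenMultiplicity A φ (Complex.I * (Real.sqrt d : ℂ)) = 18 ∨
      eigenMultiplicity A φ (-(Complex.I * (Real.sqrt d : ℂ))) = 18)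
    (N : ℕ) : HodgeConjectureFor (A.powSucc N).dim (A.powSucc N).X :=
  hodgeConjectureFor_of_isDivisorGenerated _
    (AbelianVariety.isDivisorGenerated_powSucc_of_seventyninefold_eighteenSixtyOne A φ hd hφ hE2 hX h18 N)

/-- **Ribet 1983 Thm. 3 at `(n′, n″) = (20, 59)` — UNCONDITIONAL** (core `UnitaryTwentyFiftyNine.eq_top_of_smul`).
[cite: Ribet1983, Thm. 0 and Thm. 3] [cite: Gordon1997, Thm. 6.3 (3) and Corollary] -/
theorem AbelianVariety.isDivisorGenerated_powSucc_of_ribetTypeTwentyFiftyNine (A : AbelianVariety ℂ) (φ : A ⟶ A)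
    {d : ℕ} (hd : 0 < d) (hφ : φ ≫ φ = -(d • 𝟙 A)) (hE2 : Module.finrank ℚ A.endAlgebra = 2)
    (h20 : eigenMultiplicity A φ (Complex.I * (Real.sqrt d : ℂ)) = 20)
    (h59 : eigenMultiplicity A φ (-(Complex.I * (Real.sqrt d : ℂ))) = 59) (N : ℕ) :
    IsDivisorGenerated (A.powSucc N) := by
  refine AbelianVariety.isDivisorGenerated_powSucc_of_ribetType_ofCoreSmul A φ hd hφ hE2 (by omega) (by omega) ?_ N
  intro W' _ _ _ 𝔊 ι P' Q' s hbr hirr hι hιι hP' hQ' hfinP' hfinQ' hadd hsmul hsymm hPQ hdefP hdefQ hadj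
  exact UnitaryTwentyFiftyNine.eq_top_of_smul hbr hirr hι hιι hP' hQ' (by rw [hfinP', h20]) (by rw [hfinQ', h59]) hadd
    hsmul hsymm hPQ hdefP hdefQ hadj

/-- The mirror: `n_{i√d}(φ) = 59`, `n_{−i√d}(φ) = 20` (core `UnitaryTwentyFiftyNine.eq_top_of_smul'`).
[cite: Ribet1983, Thm. 0 and Thm. 3] [cite: Gordon1997, Thm. 6.3 (3) and Corollary] -/
theorem AbelianVariety.isDivisorGenerated_powSucc_of_ribetTypeTwentyFiftyNine' (A : AbelianVariety ℂ) (φ : A ⟶ A)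
    {d : ℕ} (hd : 0 < d) (hφ : φ ≫ φ = -(d • 𝟙 A)) (hE2 : Module.finrank ℚ A.endAlgebra = 2)
    (h59 : eigenMultiplicity A φ (Complex.I * (Real.sqrt d : ℂ)) = 59)
    (h20 : eigenMultiplicity A φ (-(Complex.I * (Real.sqrt d : ℂ))) = 20) (N : ℕ) :
    IsDivisorGenerated (A.powSucc N) := by
  refine AbelianVariety.isDivisorGenerated_powSucc_of_ribetType_ofCoreSmul A φ hd hφ hE2 (by omega) (by omega) ?_ N
  intro W' _ _ _ 𝔊 ι P' Q' s hbr hirr hι hιι hP' hQ' hfinP' hfinQ' hadd hsmul hsymm hPQ hdefP hdefQ hadj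
  exact UnitaryTwentyFiftyNine.eq_top_of_smul' hbr hirr hι hιι hP' hQ' (by rw [hfinP', h59]) (by rw [hfinQ', h20])
    hadd hsmul hsymm hPQ hdefP hdefQ hadj

/-- **The Hodge conjecture for all powers `A^{N+1}` of an abelian variety of Ribet type `(20, 59)` — UNCONDITIONAL.**
[cite: Ribet1983, Thm. 3] [cite: Deligne2000, §1] -/
theorem hodgeConjectureFor_powSucc_of_ribetTypeTwentyFiftyNine (A : AbelianVariety ℂ) (φ : A ⟶ A)
    {d : ℕ} (hd : 0 < d) (hφ : φ ≫ φ = -(d • 𝟙 A)) (hE2 : Module.finrank ℚ A.endAlgebra = 2)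
    (h20 : eigenMultiplicity A φ (Complex.I * (Real.sqrt d : ℂ)) = 20)
    (h59 : eigenMultiplicity A φ (-(Complex.I * (Real.sqrt d : ℂ))) = 59) (N : ℕ) :
    HodgeConjectureFor (A.powSucc N).dim (A.powSucc N).X :=
  hodgeConjectureFor_of_isDivisorGenerated _
    (AbelianVariety.isDivisorGenerated_powSucc_of_ribetTypeTwentyFiftyNine A φ hd hφ hE2 h20 h59 N)

/-- **79-FOLDS of signature `{20, 59}`: `B• = D•` on all powers — UNCONDITIONAL** (either eigenvalue may carry the `20`).
[cite: Ribet1983, Thm. 0 and Thm. 3] [cite: MoonenZarhin1999LowDim, §2 (2.4)] -/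
theorem AbelianVariety.isDivisorGenerated_powSucc_of_seventyninefold_twentyFiftyNine (A : AbelianVariety ℂ)
    (φ : A ⟶ A) {d : ℕ} (hd : 0 < d) (hφ : φ ≫ φ = -(d • 𝟙 A)) (hE2 : Module.finrank ℚ A.endAlgebra = 2)
    (hX : A.dim = 79)
    (h20 : eigenMultiplicity A φ (Complex.I * (Real.sqrt d : ℂ)) = 20 ∨
      eigenMultiplicity A φ (-(Complex.I * (Real.sqrt d : ℂ))) = 20)
    (N : ℕ) : IsDivisorGenerated (A.powSucc N) := by
  have hsum := eigenMultiplicity_add_eigenMultiplicity_neg_eq_dim A φ hd hφ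
  rw [hX] at hsum
  rcases h20 with h | h
  · exact AbelianVariety.isDivisorGenerated_powSucc_of_ribetTypeTwentyFiftyNine A φ hd hφ hE2 h (by omega) N
  · exact AbelianVariety.isDivisorGenerated_powSucc_of_ribetTypeTwentyFiftyNine' A φ hd hφ hE2 (by omega) h N

/-- **The Hodge conjecture for all powers of a 79-FOLD of signature `{20, 59}` — UNCONDITIONAL.**
[cite: Ribet1983, Thm. 3] [cite: Deligne2000, §1] -/
theorem hodgeConjectureFor_powSucc_of_seventyninefold_twentyFiftyNine (A : AbelianVariety ℂ)
    (φ : A ⟶ A) {d : ℕ} (hd : 0 < d) (hφ : φ ≫ φ = -(d • 𝟙 A)) (hE2 : Module.finrank ℚ A.endAlgebra = 2)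
    (hX : A.dim = 79)
    (h20 : eigenMultiplicity A φ (Complex.I * (Real.sqrt d : ℂ)) = 20 ∨
      eigenMultiplicity A φ (-(Complex.I * (Real.sqrt d : ℂ))) = 20)
    (N : ℕ) : HodgeConjectureFor (A.powSucc N).dim (A.powSucc N).X :=
  hodgeConjectureFor_of_isDivisorGenerated _
    (AbelianVariety.isDivisorGenerated_powSucc_of_seventyninefold_twentyFiftyNine A φ hd hφ hE2 hX h20 N)

/-- **Ribet 1983 Thm. 3 at `(n′, n″) = (26, 53)` — UNCONDITIONAL** (core `UnitaryTwentySixFiftyThree.eq_top_of_smul`).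
[cite: Ribet1983, Thm. 0 and Thm. 3] [cite: Gordon1997, Thm. 6.3 (3) and Corollary] -/
theorem AbelianVariety.isDivisorGenerated_powSucc_of_ribetTypeTwentySixFiftyThree (A : AbelianVariety ℂ) (φ : A ⟶ A)
    {d : ℕ} (hd : 0 < d) (hφ : φ ≫ φ = -(d • 𝟙 A)) (hE2 : Module.finrank ℚ A.endAlgebra = 2)
    (h26 : eigenMultiplicity A φ (Complex.I * (Real.sqrt d : ℂ)) = 26)
    (h53 : eigenMultiplicity A φ (-(Complex.I * (Real.sqrt d : ℂ))) = 53) (N : ℕ) :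
    IsDivisorGenerated (A.powSucc N) := by
  refine AbelianVariety.isDivisorGenerated_powSucc_of_ribetType_ofCoreSmul A φ hd hφ hE2 (by omega) (by omega) ?_ N
  intro W' _ _ _ 𝔊 ι P' Q' s hbr hirr hι hιι hP' hQ' hfinP' hfinQ' hadd hsmul hsymm hPQ hdefP hdefQ hadj
  exact UnitaryTwentySixFiftyThree.eq_top_of_smul hbr hirr hι hιι hP' hQ' (by rw [hfinP', h26]) (by rw [hfinQ', h53]) hadd
    hsmul hsymm hPQ hdefP hdefQ hadj

/-- The mirror: `n_{i√d}(φ) = 53`, `n_{−i√d}(φ) = 26` (core `UnitaryTwentySixFiftyThree.eq_top_of_smul'`).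
[cite: Ribet1983, Thm. 0 and Thm. 3] [cite: Gordon1997, Thm. 6.3 (3) and Corollary] -/
theorem AbelianVariety.isDivisorGenerated_powSucc_of_ribetTypeTwentySixFiftyThree' (A : AbelianVariety ℂ) (φ : A ⟶ A)
    {d : ℕ} (hd : 0 < d) (hφ : φ ≫ φ = -(d • 𝟙 A)) (hE2 : Module.finrank ℚ A.endAlgebra = 2)
    (h53 : eigenMultiplicity A φ (Complex.I * (Real.sqrt d : ℂ)) = 53)
    (h26 : eigenMultiplicity A φ (-(Complex.I * (Real.sqrt d : ℂ))) = 26) (N : ℕ) :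
    IsDivisorGenerated (A.powSucc N) := by
  refine AbelianVariety.isDivisorGenerated_powSucc_of_ribetType_ofCoreSmul A φ hd hφ hE2 (by omega) (by omega) ?_ N
  intro W' _ _ _ 𝔊 ι P' Q' s hbr hirr hι hιι hP' hQ' hfinP' hfinQ' hadd hsmul hsymm hPQ hdefP hdefQ hadj
  exact UnitaryTwentySixFiftyThree.eq_top_of_smul' hbr hirr hι hιι hP' hQ' (by rw [hfinP', h53]) (by rw [hfinQ', h26])
    hadd hsmul hsymm hPQ hdefP hdefQ hadj

/-- **The Hodge conjecture for all powers `A^{N+1}` of an abelian variety of Ribet type `(26, 53)` — UNCONDITIONAL.**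
[cite: Ribet1983, Thm. 3] [cite: Deligne2000, §1] -/
theorem hodgeConjectureFor_powSucc_of_ribetTypeTwentySixFiftyThree (A : AbelianVariety ℂ) (φ : A ⟶ A)
    {d : ℕ} (hd : 0 < d) (hφ : φ ≫ φ = -(d • 𝟙 A)) (hE2 : Module.finrank ℚ A.endAlgebra = 2)
    (h26 : eigenMultiplicity A φ (Complex.I * (Real.sqrt d : ℂ)) = 26)
    (h53 : eigenMultiplicity A φ (-(Complex.I * (Real.sqrt d : ℂ))) = 53) (N : ℕ) :
    HodgeConjectureFor (A.powSucc N).dim (A.powSucc N).X :=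
  hodgeConjectureFor_of_isDivisorGenerated _
    (AbelianVariety.isDivisorGenerated_powSucc_of_ribetTypeTwentySixFiftyThree A φ hd hφ hE2 h26 h53 N)

/-- **79-FOLDS of signature `{26, 53}`: `B• = D•` on all powers — UNCONDITIONAL** (either eigenvalue may carry the `26`).
[cite: Ribet1983, Thm. 0 and Thm. 3] [cite: MoonenZarhin1999LowDim, §2 (2.4)] -/
theorem AbelianVariety.isDivisorGenerated_powSucc_of_seventyninefold_twentySixFiftyThree (A : AbelianVariety ℂ)
    (φ : A ⟶ A) {d : ℕ} (hd : 0 < d) (hφ : φ ≫ φ = -(d • 𝟙 A)) (hE2 : Module.finrank ℚ A.endAlgebra = 2)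
    (hX : A.dim = 79)
    (h26 : eigenMultiplicity A φ (Complex.I * (Real.sqrt d : ℂ)) = 26 ∨
      eigenMultiplicity A φ (-(Complex.I * (Real.sqrt d : ℂ))) = 26)
    (N : ℕ) : IsDivisorGenerated (A.powSucc N) := by
  have hsum := eigenMultiplicity_add_eigenMultiplicity_neg_eq_dim A φ hd hφ
  rw [hX] at hsum
  rcases h26 with h | h
  · exact AbelianVariety.isDivisorGenerated_powSucc_of_ribetTypeTwentySixFiftyThree A φ hd hφ hE2 h (by omega) N
  · exact AbelianVariety.isDivisorGenerated_powSucc_of_ribetTypeTwentySixFiftyThree' A φ hd hφ hE2 (by omega) h N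

/-- **The Hodge conjecture for all powers of a 79-FOLD of signature `{26, 53}` — UNCONDITIONAL.**
[cite: Ribet1983, Thm. 3] [cite: Deligne2000, §1] -/
theorem hodgeConjectureFor_powSucc_of_seventyninefold_twentySixFiftyThree (A : AbelianVariety ℂ)
    (φ : A ⟶ A) {d : ℕ} (hd : 0 < d) (hφ : φ ≫ φ = -(d • 𝟙 A)) (hE2 : Module.finrank ℚ A.endAlgebra = 2)
    (hX : A.dim = 79)
    (h26 : eigenMultiplicity A φ (Complex.I * (Real.sqrt d : ℂ)) = 26 ∨
      eigenMultiplicity A φ (-(Complex.I * (Real.sqrt d : ℂ))) = 26)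
    (N : ℕ) : HodgeConjectureFor (A.powSucc N).dim (A.powSucc N).X :=
  hodgeConjectureFor_of_isDivisorGenerated _
    (AbelianVariety.isDivisorGenerated_powSucc_of_seventyninefold_twentySixFiftyThree A φ hd hφ hE2 hX h26 N)

/-- **Ribet 1983 Thm. 3 at `(n′, n″) = (32, 47)` — UNCONDITIONAL** (core `UnitaryThirtyTwoFortySeven.eq_top_of_smul`).
[cite: Ribet1983, Thm. 0 and Thm. 3] [cite: Gordon1997, Thm. 6.3 (3) and Corollary] -/
theorem AbelianVariety.isDivisorGenerated_powSucc_of_ribetTypeThirtyTwoFortySeven (A : AbelianVariety ℂ) (φ : A ⟶ A)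
    {d : ℕ} (hd : 0 < d) (hφ : φ ≫ φ = -(d • 𝟙 A)) (hE2 : Module.finrank ℚ A.endAlgebra = 2)
    (h32 : eigenMultiplicity A φ (Complex.I * (Real.sqrt d : ℂ)) = 32)
    (h47 : eigenMultiplicity A φ (-(Complex.I * (Real.sqrt d : ℂ))) = 47) (N : ℕ) :
    IsDivisorGenerated (A.powSucc N) := by
  refine AbelianVariety.isDivisorGenerated_powSucc_of_ribetType_ofCoreSmul A φ hd hφ hE2 (by omega) (by omega) ?_ N
  intro W' _ _ _ 𝔊 ι P' Q' s hbr hirr hι hιι hP' hQ' hfinP' hfinQ' hadd hsmul hsymm hPQ hdefP hdefQ hadj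
  exact UnitaryThirtyTwoFortySeven.eq_top_of_smul hbr hirr hι hιι hP' hQ' (by rw [hfinP', h32]) (by rw [hfinQ', h47]) hadd
    hsmul hsymm hPQ hdefP hdefQ hadj

/-- The mirror: `n_{i√d}(φ) = 47`, `n_{−i√d}(φ) = 32` (core `UnitaryThirtyTwoFortySeven.eq_top_of_smul'`).
[cite: Ribet1983, Thm. 0 and Thm. 3] [cite: Gordon1997, Thm. 6.3 (3) and Corollary] -/
theorem AbelianVariety.isDivisorGenerated_powSucc_of_ribetTypeThirtyTwoFortySeven' (A : AbelianVariety ℂ) (φ : A ⟶ A)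
    {d : ℕ} (hd : 0 < d) (hφ : φ ≫ φ = -(d • 𝟙 A)) (hE2 : Module.finrank ℚ A.endAlgebra = 2)
    (h47 : eigenMultiplicity A φ (Complex.I * (Real.sqrt d : ℂ)) = 47)
    (h32 : eigenMultiplicity A φ (-(Complex.I * (Real.sqrt d : ℂ))) = 32) (N : ℕ) :
    IsDivisorGenerated (A.powSucc N) := by
  refine AbelianVariety.isDivisorGenerated_powSucc_of_ribetType_ofCoreSmul A φ hd hφ hE2 (by omega) (by omega) ?_ N
  intro W' _ _ _ 𝔊 ι P' Q' s hbr hirr hι hιι hP' hQ' hfinP' hfinQ' hadd hsmul hsymm hPQ hdefP hdefQ hadj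
  exact UnitaryThirtyTwoFortySeven.eq_top_of_smul' hbr hirr hι hιι hP' hQ' (by rw [hfinP', h47]) (by rw [hfinQ', h32])
    hadd hsmul hsymm hPQ hdefP hdefQ hadj

/-- **The Hodge conjecture for all powers `A^{N+1}` of an abelian variety of Ribet type `(32, 47)` — UNCONDITIONAL.**
[cite: Ribet1983, Thm. 3] [cite: Deligne2000, §1] -/
theorem hodgeConjectureFor_powSucc_of_ribetTypeThirtyTwoFortySeven (A : AbelianVariety ℂ) (φ : A ⟶ A)
    {d : ℕ} (hd : 0 < d) (hφ : φ ≫ φ = -(d • 𝟙 A)) (hE2 : Module.finrank ℚ A.endAlgebra = 2)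
    (h32 : eigenMultiplicity A φ (Complex.I * (Real.sqrt d : ℂ)) = 32)
    (h47 : eigenMultiplicity A φ (-(Complex.I * (Real.sqrt d : ℂ))) = 47) (N : ℕ) :
    HodgeConjectureFor (A.powSucc N).dim (A.powSucc N).X :=
  hodgeConjectureFor_of_isDivisorGenerated _
    (AbelianVariety.isDivisorGenerated_powSucc_of_ribetTypeThirtyTwoFortySeven A φ hd hφ hE2 h32 h47 N)

/-- **79-FOLDS of signature `{32, 47}`: `B• = D•` on all powers — UNCONDITIONAL** (either eigenvalue may carry the `32`).
[cite: Ribet1983, Thm. 0 and Thm. 3] [cite: MoonenZarhin1999LowDim, §2 (2.4)] -/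
theorem AbelianVariety.isDivisorGenerated_powSucc_of_seventyninefold_thirtyTwoFortySeven (A : AbelianVariety ℂ)
    (φ : A ⟶ A) {d : ℕ} (hd : 0 < d) (hφ : φ ≫ φ = -(d • 𝟙 A)) (hE2 : Module.finrank ℚ A.endAlgebra = 2)
    (hX : A.dim = 79)
    (h32 : eigenMultiplicity A φ (Complex.I * (Real.sqrt d : ℂ)) = 32 ∨
      eigenMultiplicity A φ (-(Complex.I * (Real.sqrt d : ℂ))) = 32)
    (N : ℕ) : IsDivisorGenerated (A.powSucc N) := by
  have hsum := eigenMultiplicity_add_eigenMultiplicity_neg_eq_dim A φ hd hφ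
  rw [hX] at hsum
  rcases h32 with h | h
  · exact AbelianVariety.isDivisorGenerated_powSucc_of_ribetTypeThirtyTwoFortySeven A φ hd hφ hE2 h (by omega) N
  · exact AbelianVariety.isDivisorGenerated_powSucc_of_ribetTypeThirtyTwoFortySeven' A φ hd hφ hE2 (by omega) h N

/-- **The Hodge conjecture for all powers of a 79-FOLD of signature `{32, 47}` — UNCONDITIONAL.**
[cite: Ribet1983, Thm. 3] [cite: Deligne2000, §1] -/
theorem hodgeConjectureFor_powSucc_of_seventyninefold_thirtyTwoFortySeven (A : AbelianVariety ℂ)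
    (φ : A ⟶ A) {d : ℕ} (hd : 0 < d) (hφ : φ ≫ φ = -(d • 𝟙 A)) (hE2 : Module.finrank ℚ A.endAlgebra = 2)
    (hX : A.dim = 79)
    (h32 : eigenMultiplicity A φ (Complex.I * (Real.sqrt d : ℂ)) = 32 ∨
      eigenMultiplicity A φ (-(Complex.I * (Real.sqrt d : ℂ))) = 32)
    (N : ℕ) : HodgeConjectureFor (A.powSucc N).dim (A.powSucc N).X :=
  hodgeConjectureFor_of_isDivisorGenerated _
    (AbelianVariety.isDivisorGenerated_powSucc_of_seventyninefold_thirtyTwoFortySeven A φ hd hφ hE2 hX h32 N)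

/-- **Ribet 1983 Thm. 3 at `(n′, n″) = (36, 43)` — UNCONDITIONAL** (core `UnitaryThirtySixFortyThree.eq_top_of_smul`).
[cite: Ribet1983, Thm. 0 and Thm. 3] [cite: Gordon1997, Thm. 6.3 (3) and Corollary] -/
theorem AbelianVariety.isDivisorGenerated_powSucc_of_ribetTypeThirtySixFortyThree (A : AbelianVariety ℂ) (φ : A ⟶ A)
    {d : ℕ} (hd : 0 < d) (hφ : φ ≫ φ = -(d • 𝟙 A)) (hE2 : Module.finrank ℚ A.endAlgebra = 2)
    (h36 : eigenMultiplicity A φ (Complex.I * (Real.sqrt d : ℂ)) = 36)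
    (h43 : eigenMultiplicity A φ (-(Complex.I * (Real.sqrt d : ℂ))) = 43) (N : ℕ) :
    IsDivisorGenerated (A.powSucc N) := by
  refine AbelianVariety.isDivisorGenerated_powSucc_of_ribetType_ofCoreSmul A φ hd hφ hE2 (by omega) (by omega) ?_ N
  intro W' _ _ _ 𝔊 ι P' Q' s hbr hirr hι hιι hP' hQ' hfinP' hfinQ' hadd hsmul hsymm hPQ hdefP hdefQ hadj
  exact UnitaryThirtySixFortyThree.eq_top_of_smul hbr hirr hι hιι hP' hQ' (by rw [hfinP', h36]) (by rw [hfinQ', h43]) hadd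
    hsmul hsymm hPQ hdefP hdefQ hadj

/-- The mirror: `n_{i√d}(φ) = 43`, `n_{−i√d}(φ) = 36` (core `UnitaryThirtySixFortyThree.eq_top_of_smul'`).
[cite: Ribet1983, Thm. 0 and Thm. 3] [cite: Gordon1997, Thm. 6.3 (3) and Corollary] -/
theorem AbelianVariety.isDivisorGenerated_powSucc_of_ribetTypeThirtySixFortyThree' (A : AbelianVariety ℂ) (φ : A ⟶ A)
    {d : ℕ} (hd : 0 < d) (hφ : φ ≫ φ = -(d • 𝟙 A)) (hE2 : Module.finrank ℚ A.endAlgebra = 2)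
    (h43 : eigenMultiplicity A φ (Complex.I * (Real.sqrt d : ℂ)) = 43)
    (h36 : eigenMultiplicity A φ (-(Complex.I * (Real.sqrt d : ℂ))) = 36) (N : ℕ) :
    IsDivisorGenerated (A.powSucc N) := by
  refine AbelianVariety.isDivisorGenerated_powSucc_of_ribetType_ofCoreSmul A φ hd hφ hE2 (by omega) (by omega) ?_ N
  intro W' _ _ _ 𝔊 ι P' Q' s hbr hirr hι hιι hP' hQ' hfinP' hfinQ' hadd hsmul hsymm hPQ hdefP hdefQ hadj
  exact UnitaryThirtySixFortyThree.eq_top_of_smul' hbr hirr hι hιι hP' hQ' (by rw [hfinP', h43]) (by rw [hfinQ', h36])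
    hadd hsmul hsymm hPQ hdefP hdefQ hadj

/-- **The Hodge conjecture for all powers `A^{N+1}` of an abelian variety of Ribet type `(36, 43)` — UNCONDITIONAL.**
[cite: Ribet1983, Thm. 3] [cite: Deligne2000, §1] -/
theorem hodgeConjectureFor_powSucc_of_ribetTypeThirtySixFortyThree (A : AbelianVariety ℂ) (φ : A ⟶ A)
    {d : ℕ} (hd : 0 < d) (hφ : φ ≫ φ = -(d • 𝟙 A)) (hE2 : Module.finrank ℚ A.endAlgebra = 2)
    (h36 : eigenMultiplicity A φ (Complex.I * (Real.sqrt d : ℂ)) = 36)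
    (h43 : eigenMultiplicity A φ (-(Complex.I * (Real.sqrt d : ℂ))) = 43) (N : ℕ) :
    HodgeConjectureFor (A.powSucc N).dim (A.powSucc N).X :=
  hodgeConjectureFor_of_isDivisorGenerated _
    (AbelianVariety.isDivisorGenerated_powSucc_of_ribetTypeThirtySixFortyThree A φ hd hφ hE2 h36 h43 N)

/-- **79-FOLDS of signature `{36, 43}`: `B• = D•` on all powers — UNCONDITIONAL** (either eigenvalue may carry the `36`).
[cite: Ribet1983, Thm. 0 and Thm. 3] [cite: MoonenZarhin1999LowDim, §2 (2.4)] -/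
theorem AbelianVariety.isDivisorGenerated_powSucc_of_seventyninefold_thirtySixFortyThree (A : AbelianVariety ℂ)
    (φ : A ⟶ A) {d : ℕ} (hd : 0 < d) (hφ : φ ≫ φ = -(d • 𝟙 A)) (hE2 : Module.finrank ℚ A.endAlgebra = 2)
    (hX : A.dim = 79)
    (h36 : eigenMultiplicity A φ (Complex.I * (Real.sqrt d : ℂ)) = 36 ∨
      eigenMultiplicity A φ (-(Complex.I * (Real.sqrt d : ℂ))) = 36)
    (N : ℕ) : IsDivisorGenerated (A.powSucc N) := by
  have hsum := eigenMultiplicity_add_eigenMultiplicity_neg_eq_dim A φ hd hφ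
  rw [hX] at hsum
  rcases h36 with h | h
  · exact AbelianVariety.isDivisorGenerated_powSucc_of_ribetTypeThirtySixFortyThree A φ hd hφ hE2 h (by omega) N
  · exact AbelianVariety.isDivisorGenerated_powSucc_of_ribetTypeThirtySixFortyThree' A φ hd hφ hE2 (by omega) h N

/-- **The Hodge conjecture for all powers of a 79-FOLD of signature `{36, 43}` — UNCONDITIONAL.**
[cite: Ribet1983, Thm. 3] [cite: Deligne2000, §1] -/
theorem hodgeConjectureFor_powSucc_of_seventyninefold_thirtySixFortyThree (A : AbelianVariety ℂ)
    (φ : A ⟶ A) {d : ℕ} (hd : 0 < d) (hφ : φ ≫ φ = -(d • 𝟙 A)) (hE2 : Module.finrank ℚ A.endAlgebra = 2)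
    (hX : A.dim = 79)
    (h36 : eigenMultiplicity A φ (Complex.I * (Real.sqrt d : ℂ)) = 36 ∨
      eigenMultiplicity A φ (-(Complex.I * (Real.sqrt d : ℂ))) = 36)
    (N : ℕ) : HodgeConjectureFor (A.powSucc N).dim (A.powSucc N).X :=
  hodgeConjectureFor_of_isDivisorGenerated _
    (AbelianVariety.isDivisorGenerated_powSucc_of_seventyninefold_thirtySixFortyThree A φ hd hφ hE2 hX h36 N)

/-- **Ribet 1983 Thm. 3 at `(n′, n″) = (38, 41)` — UNCONDITIONAL** (core `UnitaryThirtyEightFortyOne.eq_top_of_smul`).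
[cite: Ribet1983, Thm. 0 and Thm. 3] [cite: Gordon1997, Thm. 6.3 (3) and Corollary] -/
theorem AbelianVariety.isDivisorGenerated_powSucc_of_ribetTypeThirtyEightFortyOne (A : AbelianVariety ℂ) (φ : A ⟶ A)
    {d : ℕ} (hd : 0 < d) (hφ : φ ≫ φ = -(d • 𝟙 A)) (hE2 : Module.finrank ℚ A.endAlgebra = 2)
    (h38 : eigenMultiplicity A φ (Complex.I * (Real.sqrt d : ℂ)) = 38)
    (h41 : eigenMultiplicity A φ (-(Complex.I * (Real.sqrt d : ℂ))) = 41) (N : ℕ) :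
    IsDivisorGenerated (A.powSucc N) := by
  refine AbelianVariety.isDivisorGenerated_powSucc_of_ribetType_ofCoreSmul A φ hd hφ hE2 (by omega) (by omega) ?_ N
  intro W' _ _ _ 𝔊 ι P' Q' s hbr hirr hι hιι hP' hQ' hfinP' hfinQ' hadd hsmul hsymm hPQ hdefP hdefQ hadj
  exact UnitaryThirtyEightFortyOne.eq_top_of_smul hbr hirr hι hιι hP' hQ' (by rw [hfinP', h38]) (by rw [hfinQ', h41]) hadd
    hsmul hsymm hPQ hdefP hdefQ hadj

/-- The mirror: `n_{i√d}(φ) = 41`, `n_{−i√d}(φ) = 38` (core `UnitaryThirtyEightFortyOne.eq_top_of_smul'`).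
[cite: Ribet1983, Thm. 0 and Thm. 3] [cite: Gordon1997, Thm. 6.3 (3) and Corollary] -/
theorem AbelianVariety.isDivisorGenerated_powSucc_of_ribetTypeThirtyEightFortyOne' (A : AbelianVariety ℂ) (φ : A ⟶ A)
    {d : ℕ} (hd : 0 < d) (hφ : φ ≫ φ = -(d • 𝟙 A)) (hE2 : Module.finrank ℚ A.endAlgebra = 2)
    (h41 : eigenMultiplicity A φ (Complex.I * (Real.sqrt d : ℂ)) = 41)
    (h38 : eigenMultiplicity A φ (-(Complex.I * (Real.sqrt d : ℂ))) = 38) (N : ℕ) :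
    IsDivisorGenerated (A.powSucc N) := by
  refine AbelianVariety.isDivisorGenerated_powSucc_of_ribetType_ofCoreSmul A φ hd hφ hE2 (by omega) (by omega) ?_ N
  intro W' _ _ _ 𝔊 ι P' Q' s hbr hirr hι hιι hP' hQ' hfinP' hfinQ' hadd hsmul hsymm hPQ hdefP hdefQ hadj
  exact UnitaryThirtyEightFortyOne.eq_top_of_smul' hbr hirr hι hιι hP' hQ' (by rw [hfinP', h41]) (by rw [hfinQ', h38])
    hadd hsmul hsymm hPQ hdefP hdefQ hadj

/-- **The Hodge conjecture for all powers `A^{N+1}` of an abelian variety of Ribet type `(38, 41)` — UNCONDITIONAL.**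
[cite: Ribet1983, Thm. 3] [cite: Deligne2000, §1] -/
theorem hodgeConjectureFor_powSucc_of_ribetTypeThirtyEightFortyOne (A : AbelianVariety ℂ) (φ : A ⟶ A)
    {d : ℕ} (hd : 0 < d) (hφ : φ ≫ φ = -(d • 𝟙 A)) (hE2 : Module.finrank ℚ A.endAlgebra = 2)
    (h38 : eigenMultiplicity A φ (Complex.I * (Real.sqrt d : ℂ)) = 38)
    (h41 : eigenMultiplicity A φ (-(Complex.I * (Real.sqrt d : ℂ))) = 41) (N : ℕ) :
    HodgeConjectureFor (A.powSucc N).dim (A.powSucc N).X :=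
  hodgeConjectureFor_of_isDivisorGenerated _
    (AbelianVariety.isDivisorGenerated_powSucc_of_ribetTypeThirtyEightFortyOne A φ hd hφ hE2 h38 h41 N)

/-- **79-FOLDS of signature `{38, 41}`: `B• = D•` on all powers — UNCONDITIONAL** (either eigenvalue may carry the `38`).
[cite: Ribet1983, Thm. 0 and Thm. 3] [cite: MoonenZarhin1999LowDim, §2 (2.4)] -/
theorem AbelianVariety.isDivisorGenerated_powSucc_of_seventyninefold_thirtyEightFortyOne (A : AbelianVariety ℂ)
    (φ : A ⟶ A) {d : ℕ} (hd : 0 < d) (hφ : φ ≫ φ = -(d • 𝟙 A)) (hE2 : Module.finrank ℚ A.endAlgebra = 2)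
    (hX : A.dim = 79)
    (h38 : eigenMultiplicity A φ (Complex.I * (Real.sqrt d : ℂ)) = 38 ∨
      eigenMultiplicity A φ (-(Complex.I * (Real.sqrt d : ℂ))) = 38)
    (N : ℕ) : IsDivisorGenerated (A.powSucc N) := by
  have hsum := eigenMultiplicity_add_eigenMultiplicity_neg_eq_dim A φ hd hφ
  rw [hX] at hsum
  rcases h38 with h | h
  · exact AbelianVariety.isDivisorGenerated_powSucc_of_ribetTypeThirtyEightFortyOne A φ hd hφ hE2 h (by omega) N
  · exact AbelianVariety.isDivisorGenerated_powSucc_of_ribetTypeThirtyEightFortyOne' A φ hd hφ hE2 (by omega) h N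

/-- **The Hodge conjecture for all powers of a 79-FOLD of signature `{38, 41}` — UNCONDITIONAL.**
[cite: Ribet1983, Thm. 3] [cite: Deligne2000, §1] -/
theorem hodgeConjectureFor_powSucc_of_seventyninefold_thirtyEightFortyOne (A : AbelianVariety ℂ)
    (φ : A ⟶ A) {d : ℕ} (hd : 0 < d) (hφ : φ ≫ φ = -(d • 𝟙 A)) (hE2 : Module.finrank ℚ A.endAlgebra = 2)
    (hX : A.dim = 79)
    (h38 : eigenMultiplicity A φ (Complex.I * (Real.sqrt d : ℂ)) = 38 ∨
      eigenMultiplicity A φ (-(Complex.I * (Real.sqrt d : ℂ))) = 38)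
    (N : ℕ) : HodgeConjectureFor (A.powSucc N).dim (A.powSucc N).X :=
  hodgeConjectureFor_of_isDivisorGenerated _
    (AbelianVariety.isDivisorGenerated_powSucc_of_seventyninefold_thirtyEightFortyOne A φ hd hφ hE2 hX h38 N)

end Cells

/-! ### §2 The 79-fold census -/

section Census

variable {X : AbelianVariety ℂ}

/-- **`B• = D•` on all powers of a SIMPLE complex abelian `79`-FOLD, granted ONLY `End⁰ = ℚ` and the `k`-signatures
`{9, 70}`, `{10, 69}`, `{14, 65}`, `{15, 64}`, `{16, 63}`, `{17, 62}`, `{19, 60}`, `{21, 58}`, `{22, 57}`, `{23, 56}`, `{24, 55}`, `{25, 54}`, `{27, 52}`, `{28, 51}`, `{29, 50}`, `{30, 49}`, `{31, 48}`, `{33, 46}`, `{34, 45}`, `{35, 44}`, `{37, 42}`, `{39, 40}`** (the shapes with a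
multiplicity `≤ 7` or in `{11, 13}` are generic tree theorems; `{8, 71}`, `{12, 67}`, `{18, 61}`, `{20, 59}`, `{26, 53}`, `{32, 47}`, `{36, 43}`, `{38, 41}` are cells).
[cite: MoonenZarhin1999LowDim, §2 (2.4) and Thm. (2.7)] [cite: Ribet1983, Thms. 0–3] [cite: Gordon1997, Thm. 6.3 and Corollary] -/
theorem isDivisorGenerated_powSucc_of_isSimple_seventyninefold (hs : X.IsSimple) (hX : X.dim = 79)
    (h1 : Module.finrank ℚ X.endAlgebra = 1 → ∀ N : ℕ, IsDivisorGenerated (X.powSucc N))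
    (hres : ∀ (φ : X ⟶ X) (d : ℕ), 0 < d → φ ≫ φ = -(d • 𝟙 X) → Module.finrank ℚ X.endAlgebra = 2 →
      (eigenMultiplicity X φ (Complex.I * (Real.sqrt d : ℂ)) = 9 ∨ eigenMultiplicity X φ (Complex.I * (Real.sqrt d : ℂ)) = 10 ∨ eigenMultiplicity X φ (Complex.I * (Real.sqrt d : ℂ)) = 14 ∨ eigenMultiplicity X φ (Complex.I * (Real.sqrt d : ℂ)) = 15 ∨ eigenMultiplicity X φ (Complex.I * (Real.sqrt d : ℂ)) = 16 ∨ eigenMultiplicity X φ (Complex.I * (Real.sqrt d : ℂ)) = 17 ∨ eigenMultiplicity X φ (Complex.I * (Real.sqrt d : ℂ)) = 19 ∨ eigenMultiplicity X φ (Complex.I * (Real.sqrt d : ℂ)) = 21 ∨ eigenMultiplicity X φ (Complex.I * (Real.sqrt d : ℂ)) = 22 ∨ eigenMultiplicity X φ (Complex.I * (Real.sqrt d : ℂ)) = 23 ∨ eigenMultiplicity X φ (Complex.I * (Real.sqrt d : ℂ)) = 24 ∨ eigenMultiplicity X φ (Complex.I * (Real.sqrt d : ℂ)) = 25 ∨ eigenMultiplicity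 X φ (Complex.I * (Real.sqrt d : ℂ)) = 27 ∨ eigenMultiplicity X φ (Complex.I * (Real.sqrt d : ℂ)) = 28 ∨ eigenMultiplicity X φ (Complex.I * (Real.sqrt d : ℂ)) = 29 ∨ eigenMultiplicity X φ (Complex.I * (Real.sqrt d : ℂ)) = 30 ∨ eigenMultiplicity X φ (Complex.I * (Real.sqrt d : ℂ)) = 31 ∨ eigenMultiplicity X φ (Complex.I * (Real.sqrt d : ℂ)) = 33 ∨ eigenMultiplicity X φ (Complex.I * (Real.sqrt d : ℂ)) = 34 ∨ eigenMultiplicity X φ (Complex.I * (Real.sqrt d : ℂ)) = 35 ∨ eigenMultiplicity X φ (Complex.I * (Real.sqrt d : ℂ)) = 37 ∨ eigenMultiplicity X φ (Complex.I * (Real.sqrt d : ℂ)) = 39 ∨ eigenMultiplicity X φ (Complex.I * (Real.sqrt d : ℂ)) = 40 ∨ eigenMultiplicity X φ (Complex.I * (Real.sqrt d : ℂ)) = 42 ∨ eigenMultiplicity X φ (Complex.I * (Real.sqrt d : ℂ)) = 44 ∨ eigenMultiplicity X φ (Complex.I * (Real.sqrt d : ℂ)) = 45 ∨ eigenMultiplicity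 X φ (Complex.I * (Real.sqrt d : ℂ)) = 46 ∨ eigenMultiplicity X φ (Complex.I * (Real.sqrt d : ℂ)) = 48 ∨ eigenMultiplicity X φ (Complex.I * (Real.sqrt d : ℂ)) = 49 ∨ eigenMultiplicity X φ (Complex.I * (Real.sqrt d : ℂ)) = 50 ∨ eigenMultiplicity X φ (Complex.I * (Real.sqrt d : ℂ)) = 51 ∨ eigenMultiplicity X φ (Complex.I * (Real.sqrt d : ℂ)) = 52 ∨ eigenMultiplicity X φ (Complex.I * (Real.sqrt d : ℂ)) = 54 ∨ eigenMultiplicity X φ (Complex.I * (Real.sqrt d : ℂ)) = 55 ∨ eigenMultiplicity X φ (Complex.I * (Real.sqrt d : ℂ)) = 56 ∨ eigenMultiplicity X φ (Complex.I * (Real.sqrt d : ℂ)) = 57 ∨ eigenMultiplicity X φ (Complex.I * (Real.sqrt d : ℂ)) = 58 ∨ eigenMultiplicity X φ (Complex.I * (Real.sqrt d : ℂ)) = 60 ∨ eigenMultiplicity X φ (Complex.I * (Real.sqrt d : ℂ)) = 62 ∨ eigenMultiplicity X φ (Complex.I * (Real.sqrt d : ℂ)) = 63 ∨ eigenMultiplicity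 X φ (Complex.I * (Real.sqrt d : ℂ)) = 64 ∨ eigenMultiplicity X φ (Complex.I * (Real.sqrt d : ℂ)) = 65 ∨ eigenMultiplicity X φ (Complex.I * (Real.sqrt d : ℂ)) = 69 ∨ eigenMultiplicity X φ (Complex.I * (Real.sqrt d : ℂ)) = 70) →
      ∀ N : ℕ, IsDivisorGenerated (X.powSucc N))
    (N : ℕ) : IsDivisorGenerated (X.powSucc N) := by
  refine isDivisorGenerated_powSucc_of_isSimple_of_prime_of_odd_of_ge_eight_notin hs (by rw [hX]; norm_num)
    (by rw [hX]; exact ⟨39, rfl⟩) h1 (fun φ d hd hφ he2 ha hb h11a h11b h13a h13b N => ?_) N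
  have hsum := eigenMultiplicity_add_eigenMultiplicity_neg_eq_dim X φ hd hφ
  rw [hX] at hsum
  by_cases h8 : eigenMultiplicity X φ (Complex.I * (Real.sqrt d : ℂ)) = 8 ∨ eigenMultiplicity X φ (-(Complex.I * (Real.sqrt d : ℂ))) = 8
  · exact AbelianVariety.isDivisorGenerated_powSucc_of_seventyninefold_eightSeventyOne X φ hd hφ he2 hX h8 N
  by_cases h12 : eigenMultiplicity X φ (Complex.I * (Real.sqrt d : ℂ)) = 12 ∨ eigenMultiplicity X φ (-(Complex.I * (Real.sqrt d : ℂ))) = 12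
  · exact AbelianVariety.isDivisorGenerated_powSucc_of_seventyninefold_twelveSixtySeven X φ hd hφ he2 hX h12 N
  by_cases h18 : eigenMultiplicity X φ (Complex.I * (Real.sqrt d : ℂ)) = 18 ∨ eigenMultiplicity X φ (-(Complex.I * (Real.sqrt d : ℂ))) = 18
  · exact AbelianVariety.isDivisorGenerated_powSucc_of_seventyninefold_eighteenSixtyOne X φ hd hφ he2 hX h18 N
  by_cases h20 : eigenMultiplicity X φ (Complex.I * (Real.sqrt d : ℂ)) = 20 ∨ eigenMultiplicity X φ (-(Complex.I * (Real.sqrt d : ℂ))) = 20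
  · exact AbelianVariety.isDivisorGenerated_powSucc_of_seventyninefold_twentyFiftyNine X φ hd hφ he2 hX h20 N
  by_cases h26 : eigenMultiplicity X φ (Complex.I * (Real.sqrt d : ℂ)) = 26 ∨ eigenMultiplicity X φ (-(Complex.I * (Real.sqrt d : ℂ))) = 26
  · exact AbelianVariety.isDivisorGenerated_powSucc_of_seventyninefold_twentySixFiftyThree X φ hd hφ he2 hX h26 N
  by_cases h32 : eigenMultiplicity X φ (Complex.I * (Real.sqrt d : ℂ)) = 32 ∨ eigenMultiplicity X φ (-(Complex.I * (Real.sqrt d : ℂ))) = 32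
  · exact AbelianVariety.isDivisorGenerated_powSucc_of_seventyninefold_thirtyTwoFortySeven X φ hd hφ he2 hX h32 N
  by_cases h36 : eigenMultiplicity X φ (Complex.I * (Real.sqrt d : ℂ)) = 36 ∨ eigenMultiplicity X φ (-(Complex.I * (Real.sqrt d : ℂ))) = 36
  · exact AbelianVariety.isDivisorGenerated_powSucc_of_seventyninefold_thirtySixFortyThree X φ hd hφ he2 hX h36 N
  by_cases h38 : eigenMultiplicity X φ (Complex.I * (Real.sqrt d : ℂ)) = 38 ∨ eigenMultiplicity X φ (-(Complex.I * (Real.sqrt d : ℂ))) = 38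
  · exact AbelianVariety.isDivisorGenerated_powSucc_of_seventyninefold_thirtyEightFortyOne X φ hd hφ he2 hX h38 N
  exact hres φ d hd hφ he2 (by omega) N

/-- **The Hodge conjecture on all powers of a SIMPLE complex abelian `79`-FOLD, granted ONLY `End⁰ = ℚ` and the
`k`-signatures above.** [cite: Ribet1983, Thms. 0–3] [cite: Deligne2000, §1] -/
theorem hodgeConjectureFor_powSucc_of_isSimple_seventyninefold (hs : X.IsSimple) (hX : X.dim = 79)
    (h1 : Module.finrank ℚ X.endAlgebra = 1 → ∀ N : ℕ, IsDivisorGenerated (X.powSucc N))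
    (hres : ∀ (φ : X ⟶ X) (d : ℕ), 0 < d → φ ≫ φ = -(d • 𝟙 X) → Module.finrank ℚ X.endAlgebra = 2 →
      (eigenMultiplicity X φ (Complex.I * (Real.sqrt d : ℂ)) = 9 ∨ eigenMultiplicity X φ (Complex.I * (Real.sqrt d : ℂ)) = 10 ∨ eigenMultiplicity X φ (Complex.I * (Real.sqrt d : ℂ)) = 14 ∨ eigenMultiplicity X φ (Complex.I * (Real.sqrt d : ℂ)) = 15 ∨ eigenMultiplicity X φ (Complex.I * (Real.sqrt d : ℂ)) = 16 ∨ eigenMultiplicity X φ (Complex.I * (Real.sqrt d : ℂ)) = 17 ∨ eigenMultiplicity X φ (Complex.I * (Real.sqrt d : ℂ)) = 19 ∨ eigenMultiplicity X φ (Complex.I * (Real.sqrt d : ℂ)) = 21 ∨ eigenMultiplicity X φ (Complex.I * (Real.sqrt d : ℂ)) = 22 ∨ eigenMultiplicity X φ (Complex.I * (Real.sqrt d : ℂ)) = 23 ∨ eigenMultiplicity X φ (Complex.I * (Real.sqrt d : ℂ)) = 24 ∨ eigenMultiplicity X φ (Complex.I * (Real.sqrt d : ℂ)) = 25 ∨ eigenMultiplicity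 X φ (Complex.I * (Real.sqrt d : ℂ)) = 27 ∨ eigenMultiplicity X φ (Complex.I * (Real.sqrt d : ℂ)) = 28 ∨ eigenMultiplicity X φ (Complex.I * (Real.sqrt d : ℂ)) = 29 ∨ eigenMultiplicity X φ (Complex.I * (Real.sqrt d : ℂ)) = 30 ∨ eigenMultiplicity X φ (Complex.I * (Real.sqrt d : ℂ)) = 31 ∨ eigenMultiplicity X φ (Complex.I * (Real.sqrt d : ℂ)) = 33 ∨ eigenMultiplicity X φ (Complex.I * (Real.sqrt d : ℂ)) = 34 ∨ eigenMultiplicity X φ (Complex.I * (Real.sqrt d : ℂ)) = 35 ∨ eigenMultiplicity X φ (Complex.I * (Real.sqrt d : ℂ)) = 37 ∨ eigenMultiplicity X φ (Complex.I * (Real.sqrt d : ℂ)) = 39 ∨ eigenMultiplicity X φ (Complex.I * (Real.sqrt d : ℂ)) = 40 ∨ eigenMultiplicity X φ (Complex.I * (Real.sqrt d : ℂ)) = 42 ∨ eigenMultiplicity X φ (Complex.I * (Real.sqrt d : ℂ)) = 44 ∨ eigenMultiplicity X φ (Complex.I * (Real.sqrt d : ℂ)) = 45 ∨ eigenMultiplicity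 X φ (Complex.I * (Real.sqrt d : ℂ)) = 46 ∨ eigenMultiplicity X φ (Complex.I * (Real.sqrt d : ℂ)) = 48 ∨ eigenMultiplicity X φ (Complex.I * (Real.sqrt d : ℂ)) = 49 ∨ eigenMultiplicity X φ (Complex.I * (Real.sqrt d : ℂ)) = 50 ∨ eigenMultiplicity X φ (Complex.I * (Real.sqrt d : ℂ)) = 51 ∨ eigenMultiplicity X φ (Complex.I * (Real.sqrt d : ℂ)) = 52 ∨ eigenMultiplicity X φ (Complex.I * (Real.sqrt d : ℂ)) = 54 ∨ eigenMultiplicity X φ (Complex.I * (Real.sqrt d : ℂ)) = 55 ∨ eigenMultiplicity X φ (Complex.I * (Real.sqrt d : ℂ)) = 56 ∨ eigenMultiplicity X φ (Complex.I * (Real.sqrt d : ℂ)) = 57 ∨ eigenMultiplicity X φ (Complex.I * (Real.sqrt d : ℂ)) = 58 ∨ eigenMultiplicity X φ (Complex.I * (Real.sqrt d : ℂ)) = 60 ∨ eigenMultiplicity X φ (Complex.I * (Real.sqrt d : ℂ)) = 62 ∨ eigenMultiplicity X φ (Complex.I * (Real.sqrt d : ℂ)) = 63 ∨ eigenMultiplicity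 X φ (Complex.I * (Real.sqrt d : ℂ)) = 64 ∨ eigenMultiplicity X φ (Complex.I * (Real.sqrt d : ℂ)) = 65 ∨ eigenMultiplicity X φ (Complex.I * (Real.sqrt d : ℂ)) = 69 ∨ eigenMultiplicity X φ (Complex.I * (Real.sqrt d : ℂ)) = 70) →
      ∀ N : ℕ, IsDivisorGenerated (X.powSucc N))
    (N : ℕ) : HodgeConjectureFor (X.powSucc N).dim (X.powSucc N).X :=
  hodgeConjectureFor_of_isDivisorGenerated _ (isDivisorGenerated_powSucc_of_isSimple_seventyninefold hs hX h1 hres N)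

end Census

end Literature.AlgebraicGeometry.HodgeTheory

end

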